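import Summits.QuantumFields.BalabanUV.Beta.D1BFx.CoarseGramInverse
import Summits.QuantumFields.BalabanUV.Beta.D1BFx.PackedParity
import Summits.QuantumFields.BalabanUV.Beta.BorderedHessianSymmetry

/-!
# `BalabanUV.Beta.D1BFx.RWeightedLegPack` — road «BF-x», binder row D1, slot (K), debt X₃(ii) ROUTE T, `K-ASSEMBLY-SPEC-v2.md` §1 brick
# **3b-P «THE PACKED N-LEG»**, PART 1 (of 3): the packed `ℤ⁴` kernel `NlegK = pack(½Γ_R, ℋ_R, ℋ♭_R, 2(a′δ − Cun′))` of the R-weighted bordered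
# system, built as `comp`-PRODUCTS of three constituent packs (the fine leg, the block averaging `𝒬`, the coarse multiplier), with its kernel
# class (`Spr`) and its off-lattice zeros — the `ℤ⁴` object whose sorted periodisation the owner's 3c identifies with
# `N_T⁻¹ = massiveBlocks (½Ĝ) Q̂ (2Ĉ) (2a∕n⁸)` block by block

WHY (`HOME/b2b-balaban-beta-d1-p2/K-ASSEMBLY-SPEC-v2.md` §1, rows 3b-P ∕ 3c).  On every coarse torus the N-side inverse is the finite Woodbury
`massiveBlocks G Q C a′ = [[G − GQᵀCQG, GQᵀC],[CQG, a′·1 − C]]` (`BorderedInverseMassive`) at `G = ½Ĝ`, `C = 2Ĉ`, `a′ = 2a∕n⁸`, where `Ĝ`,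
`Q̂ = TorusCombKKT.Qhat`, `Ĉ` are the sorted periodisations of the fine leg `Ga`, of `𝒬` (the mf block of `bhK n`) and of the coarse multiplier
`Cun′ = CoarseGramInverse.multM`.  To read `N_T⁻¹` as `blocksHat p (sortK n NlegK)` with leaf-03's product rule `SortedRelInv.periodise_sortK_comp`
term by term, every block of `NlegK` must BE a `comp`-product of the same three constituents on `ℤ⁴` — which is how this file defines it:
`Gp Ga := packK Ga 0 0 0`, `Qp n := packK 0 0 (blk (bhK n) false true) 0` (so `fBL (sortK n (Qp n))` is `Qhat`'s kernel on the nose), `Cp n Cm :=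
packK 0 0 0 (embC n Cm)` (the coarse kernel placed on `n•ℤ⁴`, the `KInv` convention); `ℋ_R = Gp ∘ Qpᵀ ∘ Cp`, `ℋ♭_R = Cp ∘ Qp ∘ Gp`,
`Ga𝒬ᵀCun′𝒬Ga = ℋ_R ∘ Qp ∘ Gp`.
CONTENT (d = 3; block side `n ≥ 1`; GENERIC fine leg `Ga : MKer 4 (Fin 4)`, coarse kernel `Cm : MKer 4 (Fin 4)`, mass `a′`; all [our object] ∕ [folklore]):
* §1 constituents `embC`, `Gp`, `Qp`, `Cp`, entry lemmas, `blk_Qp_ft : blk (Qp n) false true = blk (bhK n) false true`.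
* §2 the leg: `HRp`, `HRbp`, `sandP`, **`NlegK n Ga Cm a′`**; road instance **`NlegRoad m a := NlegK (m+1) (Ga (m+1) a) (multM (m+1) (2a∕(m+1)⁸) 2) (a∕(m+1)⁸)`**.
* §3 `Spr`: `decays_embC` (rate `δ∕n`, the `KInv`-mm estimate), `spr_embC`, `spr_Gp`, `spr_Qp`, `spr_Cp`, **`spr_NlegK`**, `spr_NlegRoad` (mod `Spr (Ga (m+1) a)`).
* §4 off-lattice zeros of the multiplier ROWS and COLUMNS: `NlegK_inr_row_off`, `NlegK_inr_col_off` (+ road forms).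
NOT HERE: PART 2 `RWeightedLegPackSymm` = block covariance (`shiftK_NlegK`, `shiftK_NlegRoad`) + symmetry (`trK_NlegK`, `multM_symm`, `trK_NlegRoad`);
PART 3 `RWeightedLegPackReadout` = the fm∕mf read-out `NlegK x (n•y₀) (inl κ) (inr l) = LandauDictionaryH.HRcol n Ga Cm l y₀ κ x` and, at
the road's legs modulo [B5] Prop. 1.2 ∧ (1.126)–(1.127), `= wH κ l (x − n•y₀)` (`KInv`'s fm block); the ff read-out against `Gam` (X₄ bookkeeping);
the torus identities (3c).

HONEST FRAMING (cell contract, verbatim): «discharging `BetaPertH` makes Bałaban's UV stability UNCONDITIONAL — a real constructive-QFT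
result; it is NOT the continuum limit and NOT the Clay problem.»  HONEST DEPENDENCY (verbatim): «continuum YM on T⁴ ⇐ BetaPertH ∧ nine
spine estimates (0/9 proved); BetaPertH ⇐ (D1) ∧ (D4) ∧ CAP+tail; G-an2-4 gates asym, D1 and NE2/3/4.»  [our object] packaging + [folklore]
kernel bookkeeping over `PackedKernelSplit` (`packK`, `blk`, `spr_packK`), `PackedParity` (`trK_packK`), `BorderedHessianKernel`∕`…Symmetry`
(`bhK`, `spr_bhK`, `contourSum_delta1_eq_contourSumAdj`), `TameKernelCalculus`, `ChartConjugationRelative.spr_comp`, `CoarseGramInverse.multM`,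
`GluonLeg.Ga` BY NAME; no `Prop` is minted, nothing is cited, no wall binder is instantiated; 0 sorry.  0∕4 binders; (K) NOT closed; NOT D1, NOT
BetaPertH, NOT summit progress.  ABSOLUTE RULE (cell, verbatim): «No internally-minted statement may enter as a cited fact. Every hypothesis
is either kernel-proved in this package or a verbatim quotation of a PUBLISHED theorem with page reference. The manuscript(s) under audit are
NOT citable for their own disputed steps — they are the thing under adjudication; programme-internal (2001/route/tribunal) claims are never
citable.»
Provenance: NE9 formalisation swarm leaf prover `b2b-balaban-t4-ne9-formalise-leaf-06` (gen 29), cross-row brick «K-3b-P» (journal CLAIM ∕ SHAPE),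
2026-08-20.
-/

noncomputable section

namespace Summit.QuantumFields.BalabanUV.Beta.D1BFx.RWeightedLegPack

open Literature.Probability.LatticeModels (TorusSite Torus.proj)
open Literature.MathematicalPhysics.QuantumFieldTheory.LatticeForm (quo proj_add_zsmul)
open Literature.MathematicalPhysics.QuantumFieldTheory.Balaban1983to89
open Literature.MathematicalPhysics.QuantumFieldTheory.Balaban1983to89.Beta
open BlochFibreUniqueness (quo_add_zsmul)
open ExpKernelCalculus (MKer Decays comp shiftK l1_natSmul)
open B12Sec2to5 (l1)
open OneStepResolventKernel (Fib proj_zsmul quo_zsmul eq_zsmul_quo_of_proj)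
open HessKerRate (decays_zero)
open Summit.QuantumFields.BalabanUV.Beta.TameKernelCalculus (Tame Spr Spr.tame spr_idK trK)
open Summit.QuantumFields.BalabanUV.Beta.ChartConjugationRelative (spr_comp)
open Summit.QuantumFields.BalabanUV.Beta.BorderedHessian (bhK spr_bhK)
open Summit.QuantumFields.BalabanUV.Beta.D1BFx.PackedKernelSplit (blk packK blk_packK_tt blk_packK_tf blk_packK_ft blk_packK_ff spr_packK)
open Summit.QuantumFields.BalabanUV.Beta.D1BFx.FineHessianLegGrades (spr_add' spr_sub')
open Summit.QuantumFields.BalabanUV.Beta.D1BFx.CoarseGramInverse (multM spr_multM)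
open scoped BigOperators

variable (n : ℕ)

/-! ## §1 The three constituent packs -/

/-- [our object] **A COARSE KERNEL PLACED ON THE SUBLATTICE `n•ℤ⁴`** (the `KInv` mm convention): `embC n Cm x y m l = Cm (x∕n) (y∕n) m l` at coarse
points `x, y ∈ n•ℤ⁴`, `0` elsewhere. -/
def embC (Cm : MKer 4 (Fin 4)) : MKer 4 (Fin 4) :=
  fun x y m l => if Torus.proj n x = 0 ∧ Torus.proj n y = 0 then Cm (quo n x) (quo n y) m l else 0

/-- [our object] Unfolding of `embC`. -/
theorem embC_apply (Cm : MKer 4 (Fin 4)) (x y : Fin 4 → ℤ) (m l : Fin 4) :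
    embC n Cm x y m l = if Torus.proj n x = 0 ∧ Torus.proj n y = 0 then Cm (quo n x) (quo n y) m l else 0 := rfl

/-- [our object] `embC` at two coarse points. -/
theorem embC_coarse [NeZero n] (Cm : MKer 4 (Fin 4)) (y y' : Fin 4 → ℤ) (m l : Fin 4) :
    embC n Cm ((n : ℤ) • y) ((n : ℤ) • y') m l = Cm y y' m l := by
  simp only [embC, proj_zsmul, quo_zsmul, and_self, if_true]

/-- [our object] `embC` vanishes off the sublattice in the ROW variable. -/
theorem embC_row_off (Cm : MKer 4 (Fin 4)) {x : Fin 4 → ℤ} (hx : Torus.proj n x ≠ 0) (y : Fin 4 → ℤ) (m l : Fin 4) :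
    embC n Cm x y m l = 0 := by
  simp only [embC, hx, false_and, if_false]

/-- [our object] `embC` vanishes off the sublattice in the COLUMN variable. -/
theorem embC_col_off (Cm : MKer 4 (Fin 4)) (x : Fin 4 → ℤ) {y : Fin 4 → ℤ} (hy : Torus.proj n y ≠ 0) (m l : Fin 4) :
    embC n Cm x y m l = 0 := by
  simp only [embC, hy, and_false, if_false]

/-- [our object] `embC` is linear: subtraction. -/
theorem embC_sub (C₁ C₂ : MKer 4 (Fin 4)) : embC n (C₁ - C₂) = embC n C₁ - embC n C₂ := by
  funext x y m l
  simp only [embC, Pi.sub_apply]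
  split_ifs <;> simp

/-- [our object] `embC` is linear: scalar multiples. -/
theorem embC_smul (c : ℝ) (Cm : MKer 4 (Fin 4)) : embC n (c • Cm) = c • embC n Cm := by
  funext x y m l
  simp only [embC, Pi.smul_apply, smul_eq_mul]
  split_ifs <;> simp

/-- [our object] **THE FINE-LEG PACK** `Gp Ga := packK Ga 0 0 0` (ff block only). -/
def Gp (Ga : MKer 4 (Fin 4)) : MKer 4 (Fib 3) := packK Ga 0 0 0

/-- [our object] **THE 𝒬-PACK** `Qp n := packK 0 0 𝒬 0` with `𝒬 := blk (bhK n) false true` (the mf block of the bordered Hessian kernel — NO new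
letter: `TorusCombKKT.Qhat n p` is the torus matrix of exactly this block). -/
def Qp : MKer 4 (Fib 3) := packK 0 0 (blk (bhK (d := 3) n) false true) 0

/-- [our object] **THE COARSE-MULTIPLIER PACK** `Cp n Cm := packK 0 0 0 (embC n Cm)` (mm block only, on `n•ℤ⁴`). -/
def Cp (Cm : MKer 4 (Fin 4)) : MKer 4 (Fib 3) := packK 0 0 0 (embC n Cm)

section Entries
variable (Ga Cm : MKer 4 (Fin 4)) (x y : Fin 4 → ℤ) (κ l : Fin 4)

/-- [our object] `Gp`: ff entries. -/
@[simp] theorem Gp_inl_inl : Gp Ga x y (Sum.inl κ) (Sum.inl l) = Ga x y κ l := rfl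
/-- [our object] `Gp`: fm entries vanish. -/
@[simp] theorem Gp_inl_inr : Gp Ga x y (Sum.inl κ) (Sum.inr l) = 0 := rfl
/-- [our object] `Gp`: mf entries vanish. -/
@[simp] theorem Gp_inr_inl : Gp Ga x y (Sum.inr κ) (Sum.inl l) = 0 := rfl
/-- [our object] `Gp`: mm entries vanish. -/
@[simp] theorem Gp_inr_inr : Gp Ga x y (Sum.inr κ) (Sum.inr l) = 0 := rfl

/-- [our object] `Qp`: ff entries vanish. -/
@[simp] theorem Qp_inl_inl : Qp n x y (Sum.inl κ) (Sum.inl l) = 0 := rfl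
/-- [our object] `Qp`: fm entries vanish. -/
@[simp] theorem Qp_inl_inr : Qp n x y (Sum.inl κ) (Sum.inr l) = 0 := rfl
/-- [our object] `Qp`: mf entries ARE `bhK`'s (`+𝒬` at the coarse points). -/
theorem Qp_inr_inl : Qp n x y (Sum.inr κ) (Sum.inl l) = bhK (d := 3) n x y (Sum.inr κ) (Sum.inl l) := rfl
/-- [our object] `Qp`: mm entries vanish. -/
@[simp] theorem Qp_inr_inr : Qp n x y (Sum.inr κ) (Sum.inr l) = 0 := rfl

/-- [our object] `Cp`: ff entries vanish. -/
@[simp] theorem Cp_inl_inl : Cp n Cm x y (Sum.inl κ) (Sum.inl l) = 0 := rfl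
/-- [our object] `Cp`: fm entries vanish. -/
@[simp] theorem Cp_inl_inr : Cp n Cm x y (Sum.inl κ) (Sum.inr l) = 0 := rfl
/-- [our object] `Cp`: mf entries vanish. -/
@[simp] theorem Cp_inr_inl : Cp n Cm x y (Sum.inr κ) (Sum.inl l) = 0 := rfl
/-- [our object] `Cp`: mm entries are the placed coarse kernel. -/
theorem Cp_inr_inr : Cp n Cm x y (Sum.inr κ) (Sum.inr l) = embC n Cm x y κ l := rfl

end Entries

/-- [our object] **THE 𝒬-PACK CARRIES `bhK`'s mf BLOCK VERBATIM** (so `fBL (sortK n (Qp n)) = fBL (sortK n (bhK n))`, `TorusCombKKT.Qhat`). -/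
theorem blk_Qp_ft : blk (Qp n) false true = blk (bhK (d := 3) n) false true := rfl

/-- [our object] `Cp` is linear: subtraction. -/
theorem Cp_sub (C₁ C₂ : MKer 4 (Fin 4)) : Cp n (C₁ - C₂) = Cp n C₁ - Cp n C₂ := by
  funext x y a b
  rcases a with κ | κ <;> rcases b with l | l <;>
    simp only [Cp, packK, Pi.sub_apply, Pi.zero_apply, sub_zero, embC_sub]

/-- [our object] `Cp` is linear: scalar multiples. -/
theorem Cp_smul (c : ℝ) (Cm : MKer 4 (Fin 4)) : Cp n (c • Cm) = c • Cp n Cm := by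
  funext x y a b
  rcases a with κ | κ <;> rcases b with l | l <;>
    simp only [Cp, packK, Pi.smul_apply, Pi.zero_apply, smul_eq_mul, mul_zero, embC_smul]

/-! ## §2 The packed N-leg -/

/-- [our object] **`ℋ_R := Ga𝒬ᵀCm` AS A PACK** (fm block only): `Gp Ga ∘ (Qp n)ᵀ ∘ Cp n Cm`. -/
def HRp (Ga Cm : MKer 4 (Fin 4)) : MKer 4 (Fib 3) := comp (Gp Ga) (comp (trK (Qp n)) (Cp n Cm))

/-- [our object] **`ℋ♭_R := Cm𝒬Ga` AS A PACK** (mf block only): `Cp n Cm ∘ Qp n ∘ Gp Ga`. -/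
def HRbp (Ga Cm : MKer 4 (Fin 4)) : MKer 4 (Fib 3) := comp (Cp n Cm) (comp (Qp n) (Gp Ga))

/-- [our object] **THE SANDWICH `Ga𝒬ᵀCm𝒬Ga` AS A PACK** (ff block only): `ℋ_R ∘ Qp n ∘ Gp Ga`. -/
def sandP (Ga Cm : MKer 4 (Fin 4)) : MKer 4 (Fib 3) := comp (HRp n Ga Cm) (comp (Qp n) (Gp Ga))

/-- [our object] **THE PACKED N-LEG** `NlegK n Ga Cm a′ := pack(½Γ_R, ℋ_R, ℋ♭_R, 2(a′δ − Cm))`, `Γ_R := Ga − Ga𝒬ᵀCm𝒬Ga`, multiplier slots on `n•ℤ⁴`: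
`½•(Gp Ga − sandP) + HRp + HRbp + 2•Cp n (a′•idK − Cm)`. -/
def NlegK (Ga Cm : MKer 4 (Fin 4)) (a' : ℝ) : MKer 4 (Fib 3) :=
  (2 : ℝ)⁻¹ • (Gp Ga - sandP n Ga Cm) + HRp n Ga Cm + HRbp n Ga Cm + (2 : ℝ) • Cp n (a' • HessKerSchurResolvent.idK - Cm)

/-- [our object] **THE ROAD'S N-LEG** at block side `m + 1`, coupling `a`: fine leg `GluonLeg.Ga (m+1) a`, coarse multiplier
`Cun′ = CoarseGramInverse.multM (m+1) (2a∕(m+1)⁸) 2` (`= (m+1)⁻⁸·Cun`), mass `a′ = a∕(m+1)⁸` (so the mm block `2(a′δ − Cun′)` is `−wΦ` placed on the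
sublattice). -/
def NlegRoad (m : ℕ) (a : ℝ) : MKer 4 (Fib 3) :=
  NlegK (m + 1) (GluonLeg.Ga (m + 1) a) (multM (m + 1) (2 * a / ((m + 1 : ℕ) : ℝ) ^ 8) 2) (a / ((m + 1 : ℕ) : ℝ) ^ 8)

/-! ## §3 The kernel class: everything is spread -/

section Spread
variable [NeZero n] {Ga Cm : MKer 4 (Fin 4)}

/-- [folklore] `ℓ¹` distance of two points of the sublattice is `n` times the coarse distance. -/
theorem l1_sub_of_proj {x y : Fin 4 → ℤ} (hx : Torus.proj n x = 0) (hy : Torus.proj n y = 0) :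
    l1 (x - y) = (n : ℝ) * l1 (quo n x - quo n y) := by
  conv_lhs => rw [eq_zsmul_quo_of_proj (N := n) hx, eq_zsmul_quo_of_proj (N := n) hy, ← smul_sub]
  exact l1_natSmul n _

/-- [folklore] **DECAY OF A PLACED COARSE KERNEL** (the `KInv`-mm estimate): `Decays Cm C δ`, `0 ≤ C` ⟹ `Decays (embC n Cm) C (δ∕n)`. -/
theorem decays_embC {C δ : ℝ} (hCm : Decays Cm C δ) (hC : 0 ≤ C) : Decays (embC n Cm) C (δ / n) := by
  intro x y m l
  have hn : (0 : ℝ) < n := by exact_mod_cast Nat.pos_of_ne_zero (NeZero.ne n)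
  by_cases hxy : Torus.proj n x = 0 ∧ Torus.proj n y = 0
  · rw [embC_apply, if_pos hxy]
    calc |Cm (quo n x) (quo n y) m l| ≤ C * Real.exp (-δ * l1 (quo n x - quo n y)) := hCm _ _ m l
      _ = C * Real.exp (-(δ / n) * l1 (x - y)) := by
          rw [l1_sub_of_proj n hxy.1 hxy.2]
          congr 2
          field_simp
  · rw [embC_apply, if_neg hxy, abs_zero]
    positivity

/-- [folklore] A placed spread coarse kernel is spread. -/
theorem spr_embC (hCm : Spr Cm) : Spr (embC n Cm) := by
  obtain ⟨C, δ, hδ, h⟩ := hCm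
  have hn : (0 : ℝ) < n := by exact_mod_cast Nat.pos_of_ne_zero (NeZero.ne n)
  have hC : 0 ≤ C := by
    have h0 := h 0 0 0 0
    exact (abs_nonneg _).trans (h0.trans (by simp [l1]))
  exact ⟨C, δ / n, div_pos hδ hn, decays_embC n h hC⟩

/-- [folklore] The zero kernel is spread. -/
theorem spr_zero' {D : ℕ} {F : Type*} [Fintype F] : Spr (0 : MKer D F) := ⟨0, 1, one_pos, decays_zero 1⟩

/-- [folklore] Scalar multiples of spread kernels are spread. -/
theorem spr_smul' {D : ℕ} {F : Type*} [Fintype F] (c : ℝ) {A : MKer D F} (hA : Spr A) : Spr (c • A) := by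
  obtain ⟨C, δ, hδ, h⟩ := hA
  refine ⟨|c| * C, δ, hδ, fun x y a b => ?_⟩
  rw [Pi.smul_apply, Pi.smul_apply, Pi.smul_apply, Pi.smul_apply, smul_eq_mul, abs_mul, mul_assoc]
  exact mul_le_mul_of_nonneg_left (h x y a b) (abs_nonneg c)

/-- [folklore] The fine-leg pack of a spread leg is spread. -/
theorem spr_Gp (hGa : Spr Ga) : Spr (Gp Ga) := spr_packK hGa spr_zero' spr_zero' spr_zero'

/-- [folklore] The 𝒬-pack is spread (`spr_bhK`: finite range). -/
theorem spr_Qp : Spr (Qp n) :=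
  spr_packK spr_zero' spr_zero' (PackedKernelSplit.spr_blk (spr_bhK (NeZero.one_le)) false true) spr_zero'

/-- [folklore] The coarse-multiplier pack of a spread coarse kernel is spread. -/
theorem spr_Cp (hCm : Spr Cm) : Spr (Cp n Cm) := spr_packK spr_zero' spr_zero' spr_zero' (spr_embC n hCm)

/-- [folklore] `ℋ_R` is spread. -/
theorem spr_HRp (hGa : Spr Ga) (hCm : Spr Cm) : Spr (HRp n Ga Cm) := spr_comp (spr_Gp hGa) (spr_comp (spr_Qp n).trK (spr_Cp n hCm))

/-- [folklore] `ℋ♭_R` is spread. -/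
theorem spr_HRbp (hGa : Spr Ga) (hCm : Spr Cm) : Spr (HRbp n Ga Cm) := spr_comp (spr_Cp n hCm) (spr_comp (spr_Qp n) (spr_Gp hGa))

/-- [folklore] The sandwich is spread. -/
theorem spr_sandP (hGa : Spr Ga) (hCm : Spr Cm) : Spr (sandP n Ga Cm) := spr_comp (spr_HRp n hGa hCm) (spr_comp (spr_Qp n) (spr_Gp hGa))

/-- [folklore] **THE PACKED N-LEG IS SPREAD** (⟸ `Spr Ga`, `Spr Cm`). -/
theorem spr_NlegK (hGa : Spr Ga) (hCm : Spr Cm) (a' : ℝ) : Spr (NlegK n Ga Cm a') := by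
  unfold NlegK
  refine spr_add' (spr_add' (spr_add' (spr_smul' _ (spr_sub' (spr_Gp hGa) (spr_sandP n hGa hCm))) (spr_HRp n hGa hCm))
    (spr_HRbp n hGa hCm)) (spr_smul' _ (spr_Cp n (spr_sub' (spr_smul' _ spr_idK) hCm)))

omit [NeZero n] in
/-- [folklore] **THE ROAD'S N-LEG IS SPREAD**, modulo the displayed `Spr (Ga (m+1) a)` (printed [B5, Prop. 1.2] ∧ (1.126)–(1.127) content). -/
theorem spr_NlegRoad (m : ℕ) (a : ℝ) (hGa : Spr (GluonLeg.Ga (m + 1) a)) : Spr (NlegRoad m a) :=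
  spr_NlegK (m + 1) hGa (spr_multM (m + 1) _ _) _

end Spread

/-! ## §4 The multiplier rows and columns vanish off the sublattice -/

section OffLattice
variable {Ga Cm : MKer 4 (Fin 4)}

/-- [folklore] A composition whose LEFT factor has no multiplier rows off the sublattice has none either. -/
theorem comp_inr_row_off {A K : MKer 4 (Fib 3)} {x : Fin 4 → ℤ} (hA : ∀ y (m : Fin 4) f, A x y (Sum.inr m) f = 0)
    (y : Fin 4 → ℤ) (m : Fin 4) (b : Fib 3) : comp A K x y (Sum.inr m) b = 0 := by
  simp only [ExpKernelCalculus.comp, hA, zero_mul, Finset.sum_const_zero, tsum_zero]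

/-- [folklore] A composition whose RIGHT factor has no multiplier columns off the sublattice has none either. -/
theorem comp_inr_col_off {A K : MKer 4 (Fib 3)} {y : Fin 4 → ℤ} (hK : ∀ z f (l : Fin 4), K z y f (Sum.inr l) = 0)
    (x : Fin 4 → ℤ) (a : Fib 3) (l : Fin 4) : comp A K x y a (Sum.inr l) = 0 := by
  simp only [ExpKernelCalculus.comp, hK, mul_zero, Finset.sum_const_zero, tsum_zero]

/-- [folklore] **MULTIPLIER ROWS OF THE N-LEG VANISH OFF `n•ℤ⁴`**. -/
theorem NlegK_inr_row_off (a' : ℝ) {x : Fin 4 → ℤ} (hx : Torus.proj n x ≠ 0) (y : Fin 4 → ℤ) (m : Fin 4) (b : Fib 3) :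
    NlegK n Ga Cm a' x y (Sum.inr m) b = 0 := by
  have hGp : ∀ y (m : Fin 4) f, Gp Ga x y (Sum.inr m) f = 0 := fun y m f => by cases f <;> rfl
  have hCp : ∀ (C' : MKer 4 (Fin 4)) y (m : Fin 4) f, Cp n C' x y (Sum.inr m) f = 0 := fun C' y m f => by
    cases f
    · rfl
    · exact embC_row_off n C' hx y m _
  have h1 : sandP n Ga Cm x y (Sum.inr m) b = 0 := comp_inr_row_off (comp_inr_row_off hGp) y m b
  have h2 : HRp n Ga Cm x y (Sum.inr m) b = 0 := comp_inr_row_off hGp y m b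
  have h3 : HRbp n Ga Cm x y (Sum.inr m) b = 0 := comp_inr_row_off (hCp Cm) y m b
  simp only [NlegK, Pi.add_apply, Pi.sub_apply, Pi.smul_apply, smul_eq_mul, h1, h2, h3, hGp, hCp, sub_zero, mul_zero, add_zero]

/-- [folklore] **MULTIPLIER COLUMNS OF THE N-LEG VANISH OFF `n•ℤ⁴`**. -/
theorem NlegK_inr_col_off (a' : ℝ) (x : Fin 4 → ℤ) {y : Fin 4 → ℤ} (hy : Torus.proj n y ≠ 0) (a : Fib 3) (l : Fin 4) :
    NlegK n Ga Cm a' x y a (Sum.inr l) = 0 := by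
  have hGp : ∀ z f (l : Fin 4), Gp Ga z y f (Sum.inr l) = 0 := fun z f l => by cases f <;> rfl
  have hCp : ∀ (C' : MKer 4 (Fin 4)) z f (l : Fin 4), Cp n C' z y f (Sum.inr l) = 0 := fun C' z f l => by
    cases f
    · rfl
    · exact embC_col_off n C' z hy _ l
  have h1 : sandP n Ga Cm x y a (Sum.inr l) = 0 := comp_inr_col_off (comp_inr_col_off hGp) x a l
  have h2 : HRp n Ga Cm x y a (Sum.inr l) = 0 := comp_inr_col_off (comp_inr_col_off (hCp Cm)) x a l
  have h3 : HRbp n Ga Cm x y a (Sum.inr l) = 0 := comp_inr_col_off (comp_inr_col_off hGp) x a l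
  simp only [NlegK, Pi.add_apply, Pi.sub_apply, Pi.smul_apply, smul_eq_mul, h1, h2, h3, hGp, hCp, sub_zero, mul_zero, add_zero]

/-- [folklore] Road form: multiplier rows of `NlegRoad m a` vanish off `(m+1)•ℤ⁴`. -/
theorem NlegRoad_inr_row_off (m : ℕ) (a : ℝ) {x : Fin 4 → ℤ} (hx : Torus.proj (m + 1) x ≠ 0) (y : Fin 4 → ℤ) (m' : Fin 4) (b : Fib 3) :
    NlegRoad m a x y (Sum.inr m') b = 0 :=
  NlegK_inr_row_off (m + 1) _ hx y m' b

/-- [folklore] Road form: multiplier columns of `NlegRoad m a` vanish off `(m+1)•ℤ⁴`. -/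
theorem NlegRoad_inr_col_off (m : ℕ) (a : ℝ) (x : Fin 4 → ℤ) {y : Fin 4 → ℤ} (hy : Torus.proj (m + 1) y ≠ 0) (a₀ : Fib 3) (l : Fin 4) :
    NlegRoad m a x y a₀ (Sum.inr l) = 0 :=
  NlegK_inr_col_off (m + 1) _ x hy a₀ l

end OffLattice

end Summit.QuantumFields.BalabanUV.Beta.D1BFx.RWeightedLegPack

end
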